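import Mathlib
import HarnessLib
import Summits.HubbardSuperconductivity.HubbardSuperconductivity.Theorems.KLProgrammeKLRegimeSplitTwoLegSizesMSWith
import Summits.HubbardSuperconductivity.HubbardSuperconductivity.Theorems.KLProgrammeKLRegimeSplitTwoLegSizesMSOfTableF
import Summits.HubbardSuperconductivity.HubbardSuperconductivity.Theorems.KLProgrammePerturbedFermiCurveTowerOfSizes

/-!
# Route `KLProgramme`, crux K3 — (E3a-MS) supplier, BUDGET-PARAMETRIC form, part 2: the chain profiles and the term table
# (gen-6 re-key `msBar ↦ msBarQ`, plan g14 (R12) T1b)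

Seat hubbard-kl-k3c3-p1 (g4).  Part 1 (`…TwoLegSizesMSWith`) stated the slot text with the size families `(b, B)` as parameters and
proved the profile-split step with COMPUTED sizes.  This part re-threads the budget-free ends of the (L)+(F) chain of k3c3-p1 g3 through it,
again with the sizes computed and NO fit hypothesis (`msProfileF_*`, `fermiPointLp_sizes_of_sizes`, `curveProfile_centred_sizes` imported, not copied):

* `twoLegSizesMSWith_succ_of_chainF_sizes` / `twoLegSizesMSWith_zero_of_chainF_sizes` — scale `n+1` / `0` from ANY table `Gs m j` of centred
  angular sizes of the chain-family profiles: sizes `extSize X |mean (profile m)| (Gs m j) j` (table-abstract: the DEPTH-GRADED term table of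
  `…MSChainTableGraded` — repair MS-A34 — is fed in here; the uniform-budget table of `…MSChainTableF` is NOT re-threaded, its order-3/4
  budgets `msA3 R U N`, `msA4 R U N` being the vacuous ones);
* the NAMED size shapes of a term table: base `msSizeBase X σ A₃ A₄ j = extSize X (σ 0 0) (bellCum (σ 0) (msD A₃ A₄) j) j`, slot
  `msSizeSlot X σ ε A A₃ A₄ Dt e n₀ m j = extSize X (ε m 0 + σ (m−n₀−1) 1 · msdD A A₃ A₄ Dt (e m) 0) (bellCum (ε m) (msD A₃ A₄) j + bellDiffCum (σ (m−n₀−1)) (msD A₃ A₄) (msdD A A₃ A₄ Dt (e m)) j) j`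
  (the literal left-hand sides of g3's fit hypotheses; the graded table reads them at slot-local `A₃, A₄`);
* `twoLegSizesMSWith_top_of_sizes` — the top scale `nScales β + 1` (no slots; `B` arbitrary).

Every keyed supplier theorem (the `msBar` ones, the gen-6 `msBarQ` twins, any later keying) is `(generic).mono fit_n fit_m`.
Proofs only; nothing about the model.
-/

noncomputable section

namespace Summit.HubbardSuperconductivity.HubbardSuperconductivity.Theorems.KLRegimeSplit

set_option linter.dupNamespace false -- summit = problem name (single-conjunct summit), D-0017
set_option maxSynthPendingDepth 4 -- nested operator-norm instances (symbol sizes up to order five), as in `…CompDiff`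

open Real Finset Literature.MathematicalPhysics.QuantumLattice Literature.MathematicalPhysics.QuantumLattice.FermiRG
open Literature.MathematicalPhysics.QuantumLattice.BandSectorCounting
open Summit.HubbardSuperconductivity.HubbardSuperconductivity.Theorems.KLProgrammeLegKernels
open Summit.HubbardSuperconductivity.HubbardSuperconductivity.Theorems.DispersionFlow
open Summit.HubbardSuperconductivity.HubbardSuperconductivity.Theorems.PerturbedFermiCurve

/-! ## §1 The computed sizes of the term table -/

/-- **The computed BASE size** (scale-`n₀` part) at order `j`: `extSize X (σ 0 0) (bellCum (σ 0) (msD A₃ A₄) j) j` — the increment symbol `S 0`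
read along the depth-`n₀` chain curve (Faà di Bruno sum `bellCum` against the curve sizes `msD A₃ A₄`), then G-extended. -/
def msSizeBase (X : ℝ) (σ : ℕ → ℕ → ℝ) (A₃ A₄ : ℝ) (j : ℕ) : ℝ :=
  extSize X (σ 0 0) (bellCum (σ 0) (msD A₃ A₄) j) j

/-- **The computed SLOT size** (slot `m ∈ Ioc n₀ N`, `k = m − n₀`) at order `j`: RESPONSE profile `(S k − S (k−1))∘γ_k` (sizes `ε m`,
`bellCum`) plus TRANSPORT profile `S (k−1)∘γ_k − S (k−1)∘γ_{k−1}` (sizes `σ (k−1)`, curve difference `msdD … (e m)`, `bellDiffCum`), then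
G-extended: `extSize X (ε m 0 + σ (k−1) 1 · msdD A A₃ A₄ Dt (e m) 0) (bellCum (ε m) (msD A₃ A₄) j + bellDiffCum (σ (k−1)) (msD A₃ A₄) (msdD A A₃ A₄ Dt (e m)) j) j`. -/
def msSizeSlot (X : ℝ) (σ ε : ℕ → ℕ → ℝ) (A A₃ A₄ Dt : ℝ) (e : ℕ → ℕ → ℝ) (n₀ m j : ℕ) : ℝ :=
  extSize X (ε m 0 + σ (m - n₀ - 1) 1 * msdD A A₃ A₄ Dt (e m) 0)
    (bellCum (ε m) (msD A₃ A₄) j + bellDiffCum (σ (m - n₀ - 1)) (msD A₃ A₄) (msdD A A₃ A₄ Dt (e m)) j) j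

/-- `msSizeBase` unfolded to the literal text of the landed fit hypotheses `hfit_n`. -/
theorem msSizeBase_eq (X : ℝ) (σ : ℕ → ℕ → ℝ) (A₃ A₄ : ℝ) (j : ℕ) : msSizeBase X σ A₃ A₄ j =
    (if j = 0 then σ 0 0 else 0) +
      (j.factorial : ℝ) ^ 2 * (2 * j.factorial * X * 200 ^ j) * bellCum (σ 0) (msD A₃ A₄) j *
        (4 + max 1 (((j - 1).factorial : ℝ) / (8 / 5))) ^ j := rfl

/-- `msSizeSlot` unfolded to the literal text of the landed fit hypotheses `hfit_m`. -/
theorem msSizeSlot_eq (X : ℝ) (σ ε : ℕ → ℕ → ℝ) (A A₃ A₄ Dt : ℝ) (e : ℕ → ℕ → ℝ) (n₀ m j : ℕ) :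
    msSizeSlot X σ ε A A₃ A₄ Dt e n₀ m j =
    (if j = 0 then ε m 0 + σ (m - n₀ - 1) 1 * msdD A A₃ A₄ Dt (e m) 0 else 0) +
      (j.factorial : ℝ) ^ 2 * (2 * j.factorial * X * 200 ^ j) *
        (bellCum (ε m) (msD A₃ A₄) j + bellDiffCum (σ (m - n₀ - 1)) (msD A₃ A₄) (msdD A A₃ A₄ Dt (e m)) j) *
        (4 + max 1 (((j - 1).factorial : ℝ) / (8 / 5))) ^ j := rfl

/-- The cutoff numeral is nonnegative (it bounds a norm at order `0`). -/
theorem cutoffNumeral_nonneg {X : ℝ} (hX : ∀ l ≤ 4, ∀ x : ℝ, ‖iteratedFDeriv ℝ l salmhoferCutoff x‖ ≤ X) : 0 ≤ X :=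
  (norm_nonneg _).trans (hX 0 (Nat.zero_le _) 0)

section MS

variable {L M : ℕ} [NeZero L] [NeZero M] {β U μ : ℝ}

/-! ## §2 Scale `n+1` -/

/-- **(E3a-MS), parametric, AT SCALE `n+1` FROM THE CHAIN-FAMILY PROFILES' ANGULAR SIZES** (sizes computed, no fit). -/
theorem twoLegSizesMSWith_succ_of_chainF_sizes (hμ : μ ∈ klWindowC) {K : TrigPolyC4v} {Kp : ℕ → TrigPolyC4v}
    (hK : ∀ p : Fin 2 → ℝ, K.eval p = ∑ m ∈ range (nScales β + 1), (Kp m).eval p) {n : ℕ} (hn : n + 1 ≤ nScales β) (d : ℕ)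
    (hc₁ : Continuous (klLocalPart L M β U μ K (n + 1))) (hc₀ : Continuous (klLocalPart L M β U μ K n))
    {S : ℕ → TrigPolyC4v}
    (hS : ∀ θ, klLocalPart L M β U μ K (n + 1) θ - klLocalPart L M β U μ K n θ =
      (S (nScales β - (n + 1))).eval (klFermiPoint μ K θ))
    (hC : ∀ k ≤ nScales β - (n + 1), ContDiff ℝ 4 (klFermiPoint μ (msChain d Kp (n + 1) (nScales β) k)))
    {X : ℝ} (hX : ∀ l ≤ 4, ∀ x : ℝ, ‖iteratedFDeriv ℝ l salmhoferCutoff x‖ ≤ X)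
    (Gs : ℕ → ℕ → ℝ)
    (hGs : ∀ m, ∀ j ≤ 4, ∀ i ≤ j, ∀ t : ℝ,
      ‖iteratedFDeriv ℝ i (fun t => msProfileF μ S d Kp (n + 1) (nScales β) m t -
        klAngularMean (msProfileF μ S d Kp (n + 1) (nScales β) m)) t‖ ≤ Gs m j) :
    TwoLegSizesMSWith L M β U μ K.eval (n + 1)
      (fun j => extSize X |klAngularMean (msProfileF μ S d Kp (n + 1) (nScales β) (n + 1))| (Gs (n + 1) j) j)
      (fun m j => extSize X |klAngularMean (msProfileF μ S d Kp (n + 1) (nScales β) m)| (Gs m j) j) := by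
  have hδ : (fun θ => klLocalPart L M β U μ K (n + 1) θ - klLocalPart L M β U μ K n θ) =
      curveProfile μ (S (nScales β - (n + 1))) K := by
    funext θ; rw [hS θ]; rfl
  have hP : klTwoLegPieceFn L M β U μ K.eval (n + 1) = klFrameExtFn μ (curveProfile μ (S (nScales β - (n + 1))) K) := by
    rw [klTwoLegPieceFn_eval_succ β U μ K n hc₁ hc₀, hδ]
  exact twoLegSizesMSWith_of_profile_split hμ hP (msProfileF μ S d Kp (n + 1) (nScales β))
    (fun θ => msProfileF_split μ S d hK hn θ) (contDiff_msProfileF μ S d Kp (n + 1) (nScales β) hC)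
    (msProfileF_periodic μ S d Kp (n + 1) (nScales β)) (msProfileF_even μ S d Kp (n + 1) (nScales β))
    (msProfileF_diag μ S d Kp (n + 1) (nScales β)) hX Gs hGs

/-! ## §3 Scale `0` -/

/-- **(E3a-MS), parametric, AT SCALE `0` FROM THE CHAIN-FAMILY PROFILES' ANGULAR SIZES** (sizes computed, no fit). -/
theorem twoLegSizesMSWith_zero_of_chainF_sizes (hμ : μ ∈ klWindowC) {K : TrigPolyC4v} {Kp : ℕ → TrigPolyC4v}
    (hK : ∀ p : Fin 2 → ℝ, K.eval p = ∑ m ∈ range (nScales β + 1), (Kp m).eval p) (d : ℕ)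
    (hc₀ : Continuous (klLocalPart L M β U μ K 0))
    {S : ℕ → TrigPolyC4v}
    (hS : ∀ θ, klLocalPart L M β U μ K 0 θ - K.eval (klFermiPoint μ K θ) = (S (nScales β)).eval (klFermiPoint μ K θ))
    (hC : ∀ k ≤ nScales β, ContDiff ℝ 4 (klFermiPoint μ (msChain d Kp 0 (nScales β) k)))
    {X : ℝ} (hX : ∀ l ≤ 4, ∀ x : ℝ, ‖iteratedFDeriv ℝ l salmhoferCutoff x‖ ≤ X)
    (Gs : ℕ → ℕ → ℝ)
    (hGs : ∀ m, ∀ j ≤ 4, ∀ i ≤ j, ∀ t : ℝ,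
      ‖iteratedFDeriv ℝ i (fun t => msProfileF μ S d Kp 0 (nScales β) m t -
        klAngularMean (msProfileF μ S d Kp 0 (nScales β) m)) t‖ ≤ Gs m j) :
    TwoLegSizesMSWith L M β U μ K.eval 0
      (fun j => extSize X |klAngularMean (msProfileF μ S d Kp 0 (nScales β) 0)| (Gs 0 j) j)
      (fun m j => extSize X |klAngularMean (msProfileF μ S d Kp 0 (nScales β) m)| (Gs m j) j) := by
  have hlast : klFermiPoint μ (msChain d Kp 0 (nScales β) (nScales β - 0)) = klFermiPoint μ K :=
    klFermiPoint_msChain_last d hK (Nat.zero_le _) μ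
  have hcK : Continuous fun θ => K.eval (klFermiPoint μ K θ) := by
    have h := (TrigPolyC4v.contDiff_eval K (n := 4)).continuous.comp (hC (nScales β - 0) (by omega)).continuous
    rw [hlast] at h; exact h
  have hδ : (fun θ => klLocalPart L M β U μ K 0 θ - K.eval (klFermiPoint μ K θ)) =
      curveProfile μ (S (nScales β - 0)) K := by
    funext θ; rw [hS θ, Nat.sub_zero]; rfl
  have hP : klTwoLegPieceFn L M β U μ K.eval 0 = klFrameExtFn μ (curveProfile μ (S (nScales β - 0)) K) := by
    rw [klTwoLegPieceFn_eval_zero β U μ K hc₀ hcK, hδ]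
  exact twoLegSizesMSWith_of_profile_split hμ hP (msProfileF μ S d Kp 0 (nScales β))
    (fun θ => msProfileF_split μ S d hK (Nat.zero_le _) θ)
    (contDiff_msProfileF μ S d Kp 0 (nScales β) (fun k hk => hC k (by omega)))
    (msProfileF_periodic μ S d Kp 0 (nScales β)) (msProfileF_even μ S d Kp 0 (nScales β))
    (msProfileF_diag μ S d Kp 0 (nScales β)) hX Gs hGs

/-! ## §4 The top scale -/

/-- **(E3a-MS), parametric, AT THE TOP SCALE `nScales β + 1`, frame-size keyed** (base size `extSize X (σ 0) (bellCum σ (msD A₃ A₄) j) j`;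
there are no slots, so the slot family `B` is arbitrary). -/
theorem twoLegSizesMSWith_top_of_sizes (hμ : μ ∈ klWindowC) {K : TrigPolyC4v}
    (hc₁ : Continuous (klLocalPart L M β U μ K (nScales β + 1))) (hc₀ : Continuous (klLocalPart L M β U μ K (nScales β)))
    {S : TrigPolyC4v}
    (hS : ∀ θ, klLocalPart L M β U μ K (nScales β + 1) θ - klLocalPart L M β U μ K (nScales β) θ = S.eval (klFermiPoint μ K θ))
    {A : ℝ} (hA : ∀ p : Momentum, ∀ j ≤ 2, ‖iteratedFDeriv ℝ j (frameShift K) p‖ ≤ A) (hA20 : A ≤ 1 / 20)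
    (hd : klCurveD ≤ (bandBounds (show (-4 : ℝ) < -1.1 by norm_num) (show (-1.1 : ℝ) ≤ -0.1 by norm_num)
      (show (-0.1 : ℝ) < 0 by norm_num)).Dtmin - 2 * A)
    (hlo : (-1.1 : ℝ) ≤ μ - A) (hhi : μ + A ≤ -0.1)
    {A₃ A₄ : ℝ} (hA₃ : ∀ p : Momentum, ‖iteratedFDeriv ℝ 3 (frameShift K) p‖ ≤ A₃)
    (hA₄ : ∀ p : Momentum, ‖iteratedFDeriv ℝ 4 (frameShift K) p‖ ≤ A₄)
    {σ : ℕ → ℝ} (hσnn : ∀ l, 0 ≤ σ l) (hσ0 : ∀ q : Momentum, |evalM S q| ≤ σ 0)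
    (hσ : ∀ l, 1 ≤ l → l ≤ 4 → ∀ q : Momentum, ‖iteratedFDeriv ℝ l (evalM S) q‖ ≤ σ l)
    {X : ℝ} (hX : ∀ l ≤ 4, ∀ x : ℝ, ‖iteratedFDeriv ℝ l salmhoferCutoff x‖ ≤ X) (B : ℕ → ℕ → ℝ) :
    TwoLegSizesMSWith L M β U μ K.eval (nScales β + 1) (fun j => extSize X (σ 0) (bellCum σ (msD A₃ A₄) j) j) B := by
  set N := nScales β with hNdef
  have hX0 : 0 ≤ X := cutoffNumeral_nonneg hX
  -- the curve of `K`
  have hcurve := fermiPointLp_sizes_of_sizes hA hA20 hd hlo hhi hA₃ hA₄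
  have hC : ContDiff ℝ 4 (fun θ : ℝ => (WithLp.toLp 2 (klFermiPoint μ K θ) : Momentum)) := (hcurve 0).1
  have hC' : ContDiff ℝ 4 (klFermiPoint μ K) := contDiff_of_contDiff_toLp hC
  have hD : ∀ i, 1 ≤ i → i ≤ 4 → ∀ θ,
      ‖iteratedDeriv i (fun θ : ℝ => (WithLp.toLp 2 (klFermiPoint μ K θ) : Momentum)) θ‖ ≤ msD A₃ A₄ i := by
    intro i hi1 hi4 θ
    obtain ⟨-, d1, d2, d3, d4⟩ := hcurve θ
    rw [← norm_iteratedFDeriv_eq_norm_iteratedDeriv]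
    interval_cases i
    · exact d1
    · exact d2
    · exact d3
    · exact d4
  have hDnn : ∀ i, 0 ≤ msD A₃ A₄ i := by
    intro i
    rcases i with _ | _ | _ | _ | _ | i
    · simp [msD]
    · exact (norm_nonneg _).trans (hD 1 le_rfl (by norm_num) 0)
    · exact (norm_nonneg _).trans (hD 2 (by norm_num) (by norm_num) 0)
    · exact (norm_nonneg _).trans (hD 3 (by norm_num) (by norm_num) 0)
    · exact (norm_nonneg _).trans (hD 4 (by norm_num) (by norm_num) 0)
    · simp [msD]
  -- the piece
  have hδ : (fun θ => klLocalPart L M β U μ K (N + 1) θ - klLocalPart L M β U μ K N θ) = curveProfile μ S K := by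
    funext θ; rw [hS θ]; rfl
  have hP : klTwoLegPieceFn L M β U μ K.eval (N + 1) = klFrameExtFn μ (curveProfile μ S K) := by
    rw [klTwoLegPieceFn_eval_succ β U μ K N hc₁ hc₀, hδ]
  -- the (trivial) split
  set p : ℕ → ℝ → ℝ := fun m => if m = N + 1 then curveProfile μ S K else fun _ => 0 with hpdef
  have hpN : p (N + 1) = curveProfile μ S K := by simp [hpdef]
  have hpm : ∀ m, m ≠ N + 1 → p m = fun _ => 0 := fun m hm => by simp [hpdef, hm]
  have hempty : Ioc (N + 1) (nScales β) = ∅ := Finset.Ioc_eq_empty_of_le (by omega)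
  have hW := twoLegSizesMSWith_of_profile_split hμ hP p ?_ ?_ ?_ ?_ ?_ hX
    (fun m j => if m = N + 1 then bellCum σ (msD A₃ A₄) j else 0) ?_
  · refine hW.mono ?_ ?_
    · intro j _
      rw [if_pos rfl, hpN]
      refine extSize_mono hX0 (abs_klAngularMean_le' fun θ => ?_) le_rfl j
      rw [curveProfile_apply]; exact hσ0 _
    · intro m hm
      rw [hempty] at hm
      exact absurd hm (Finset.notMem_empty m)
  · intro θ; rw [hempty, Finset.sum_empty, hpN, add_zero]
  · intro m
    by_cases hm : m = N + 1
    · subst hm; rw [hpN]; exact contDiff_curveProfile μ S K hC'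
    · rw [hpm m hm]; exact contDiff_const
  · intro m θ
    by_cases hm : m = N + 1
    · subst hm; simp only [hpN, curveProfile, klFermiPoint_periodic μ _ θ]
    · simp only [hpm m hm]
  · intro m θ
    by_cases hm : m = N + 1
    · subst hm; simp only [hpN, curveProfile, klFermiPoint_neg, TrigPolyC4v.eval_reflect]
    · simp only [hpm m hm]
  · intro m θ
    by_cases hm : m = N + 1
    · subst hm; simp only [hpN, curveProfile, klFermiPoint_pi_div_two_sub, TrigPolyC4v.eval_swap]
    · simp only [hpm m hm]
  · intro m j hj i hi t
    by_cases hm : m = N + 1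
    · subst hm
      rw [hpN, if_pos rfl]
      exact curveProfile_centred_sizes μ S K hC hσnn hDnn hσ0 hσ hD hj hi t
    · rw [hpm m hm, if_neg hm, klAngularMean_zero]
      simp

end MS

end Summit.HubbardSuperconductivity.HubbardSuperconductivity.Theorems.KLRegimeSplit

end
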